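import Summits.BirchSwinnertonDyer.BirchSwinnertonDyer.Theorems.ErratumRoadFiveClassicalValueFromPrint
import Summits.BirchSwinnertonDyer.Rank1Residual.X11b.BDPRouteHsiehFrameSupplied
import Literature.FieldTheory.AlgClosed.PadicAlgClEquivComplex
import HarnessLib

/-!
# Route `ErratumRoadFive`, crux `OpenInputNotRam` (item stmt-BirchSwinnertonDyer-19282): the ♭-TWINS of
# the registered stubs `stub_bdpDatumNotRam` (H1′) and `stub_bdpValueNotRam` (H2) — the same binders,
# the frame read in Hsieh's receptacle `𝓞_{ℂ_p}⟦T⟧` instead of `R₀⟦T⟧` — are THEOREMS FROM PRINT on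
# EVERY (¬ram) pair: Hsieh 2014 Thm. A (the frame) and Castella JIMJ 17 (2018) Thms. 2.10–2.11 (the
# value at `𝟙`, at every ♭-frame)

Cell `bsd-stepL` (run/shared/lean/pub/bsd-stepL/), seat `bsd-stepL-nram2` (prover, PART 1b residue
fan-out, 2026-08-26), `--supports stmt-BirchSwinnertonDyer-19282`. Companion of this seat's two stub
files `ErratumRoadFiveOpenInputNotRamStubBdpDatumNotRam.lean` (p462154: H1′ in the registered
`R₀`-currency on the SEMISTABLE (¬ram) pairs, from Castella 2018 Thm. 3.1) and
`ErratumRoadFiveOpenInputNotRamStubBdpValueNotRam.lean` (p462276: H2 at every `R₀`-frame on ALL (¬ram)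
pairs, from JIMJ18 Thms. 2.10–2.11).

WHY THIS FILE (a typed alternative for the planner, nothing re-registered here): the registered BC3
skeleton `Cruxes/OpenInputNotRam/Lines/birth.lean` types its BDP frame in `R₀⟦T⟧ = Λ_{R₀}`. On the
NON-semistable (¬ram) pairs (e.g. the BC5 rung `(6615d1, 5)`, `N = 3³·5·7²`) the `Λ_{R₀}`-membership
of the BDP `p`-adic `L`-function at `p ∥ N` is not a printed statement (Cas18 Thm. 3.1 stands under
"`E` semistable"; CH18 needs `p ∤ N`; JIMJ18 gives a continuous function; Hsieh 2014 gives the element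
over `Z̄_p ⊆ 𝓞_{ℂ_p}` — tree fact `hsieh2014_exists_anticyclotomicPAdicLFunction`, "`R₀`-rationality NOT
typed, NOT asserted"), so `stub_bdpDatumNotRam` has no printed source there; its `R₀`-descent is, at
`p = 3`, the cell's crux `HsiehDescentAtThree` (≈ 10 kLoC of `X11b/Three/HsiehDescent*`,
`LambdaSupply*`). Route p2 at `p ≥ 5` avoided exactly this by reading the frame in the WIDE
receptacle (`X11b/BDPRouteHsiehFrame*.lean`: "over the wide receptacle the `R₀`-descent … is NOT
NEEDED"), and bdp g12's `openInputNotRam_of_imcDivSomeFrame_of_pNew` (p442735) closes the crux body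
value-free from the ♭-divisibility (2.4)∃♭ + print. The two theorems below are the ♭-twins of the
registered H1′ ∕ H2 — binders VERBATIM, conclusion over `𝓞_{ℂ_p}⟦T⟧` (`R1.IsBDPLFunctionInt`,
`IntSeries.HasValueAt`, `‖Ω_p‖ = 1`, `‖u‖ = 1`) — so that a ♭ re-typing of the skeleton's H1′ ∕ H2
(if the planner so decides) is closable BY NAME on EVERY (¬ram) pair from the two published facts.

HONEST FRAMING: BSD is NOT proved by any of this; a closed item closes a rung leaf (K2), never summit
credit; X11b stays CONSTRUCTION-SHAPED. THEOREMS ONLY (no definition, no named fact, no `sorry`);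
CONDITIONAL on the PUBLISHED named facts listed per theorem (`hsieh2014_exists_anticyclotomicPAdicLFunction`
— Hsieh, Doc. Math. 19 (2014) Thm. A; `thm210_thm211_bdpDisplay_pNew` — Castella JIMJ 17 (2018)
Thms. 2.10–2.11 with BDP 2013's display, reviewed; `rank_eq_analyticRank_of_analyticRank_le_one` —
Gross–Zagier–Kolyvagin; `exists_isNewformOf` — modularity). Nothing booked; no skeleton is edited.

* §1 `openInputNotRam_bdpDatumFlat_of_hsieh2014` — H1′♭ on EVERY (¬ram) pair: `f = f_{Dt}`, an
  embedding datum `ι'` inducing `𝔭` (`exists_datum_forall_mem_iff`), and a ♭-frame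
  `(Ω_K ≠ 0, ‖Ω_p‖ = 1, Q ∈ 𝓞_{ℂ_p}⟦T⟧)` with Castella's interpolation property read in `𝓞_{ℂ_p}⟦T⟧`
  (`R1.IsBDPLFunctionInt`) — multr1-p2's `P2.exists_isBDPLFunctionInt_datum_of_hsieh2014_supplied`
  (Hsieh 2014 Thm. A, Castella-normalised, λ-supply discharged) at the registered binders.
* §2 `openInputNotRam_bdpValueFlat_of_pNew` — H2♭ at EVERY ♭-frame `(Ω_K ≠ 0, Ω_p ≠ 0, Q)` on EVERY
  (¬ram) pair: `Q(𝟙) = u·((1 − a_p(E) p⁻¹)·log_{ω_E} P)²` with `‖u‖ = 1`, the logarithm along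
  `embAt K p 𝔭` — by bdp g12's `continuousDisplayOnTree_of_pNew` (the JIMJ18 fact as the display's
  continuity at `𝟙` with non-zero limit), ONE-SIDED ♭-V1RIG
  (`intSeries_constantCoeff_eq_of_isBDPLFunctionInt_of_continuousValues`) and the rank-one symmetry
  `(log_{ω_E} τ_* P)² = (log_{ω_E} P)²` (`R1.sq_logOmega_map_eq_of_rank_one`). Same proof as p462276
  without the `R₀`-unit step.

References: [Hsieh2014] Thm. A p. 712 (arXiv:1112.1580 pp. 3–4); [Castella2018Exceptional] Thms.
2.10–2.11 (arXiv:1507.04260 pp. 13–14); [Castella2018] Thms. 3.1–3.2 (arXiv:1704.06608 p. 9)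
(shapes); [BertoliniDarmonPrasanna2013] Thm. 5.13, Prop. 5.10; [GrossZagier1986] Thm. I.6.3;
[Kolyvagin1990] Thm. A.
-/

set_option autoImplicit false
set_option linter.dupNamespace false

noncomputable section

open scoped Classical Topology NumberField

open Filter WeierstrassCurve NumberField IsDedekindDomain Field PowerSeries
open Literature.NumberTheory.EllipticCurves Literature.NumberTheory.EllipticCurves.ModularForms
  Literature.NumberTheory.EllipticCurves.Rank1Residual
  Literature.NumberTheory.EllipticCurves.Castella2018
  Literature.NumberTheory.EllipticCurves.Castella2018Exceptional
  Literature.NumberTheory.GaloisRepresentations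
open Summit.BirchSwinnertonDyer.Rank1Residual Summit.BirchSwinnertonDyer.Rank1Residual.X11b
  Summit.BirchSwinnertonDyer.Rank1Residual.X11b.AcSelmer
  Summit.BirchSwinnertonDyer.Rank1Residual.X11b.Halves

namespace Summit.BirchSwinnertonDyer.BirchSwinnertonDyer.Theorems

/-! ### §1 H1′♭ on every (¬ram) pair: a ♭-frame from Hsieh 2014 Thm. A -/

/-- **H1′♭ — the ♭-twin of `stub_bdpDatumNotRam` on EVERY (¬ram) pair, FROM PRINT.** At every
classical X11b datum of a (¬ram) pair — the registered binders of `stub_bdpDatumNotRam` VERBATIM —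
there are a newform `f` of `E`, an embedding datum `ι'` inducing `𝔭`, `Ω_K ≠ 0`, `Ω_p ∈ ℂ_p` with
`‖Ω_p‖ = 1` and `Q ∈ 𝓞_{ℂ_p}⟦T⟧` with Castella's interpolation property read in `𝓞_{ℂ_p}⟦T⟧`,
`R1.IsBDPLFunctionInt p ι' 𝔭 κ γ f Ω_K Ω_p Q` (Hsieh 2014 Thm. A re-normalised; multr1-p2's
`P2.exists_isBDPLFunctionInt_datum_of_hsieh2014_supplied`). Semistable OR NOT; CONDITIONAL on the
Hsieh fact only; the binders `¬ Ram W p`, `5 ≤ p`, `Surj`, `Odd d_K`, `¬ p ∣ d_K`, `¬ p ∣ #𝓞_K^×`,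
`L(E^{d_K},1) ≠ 0`, the point `P`, `he`, `hf` are idle. Nothing booked.
[cite: Hsieh2014, Thm. A p. 712 (Doc. Math. 19) = Thm. 1 (arXiv:1112.1580 pp. 3–4)]
[cite: Castella2018, Thm. 3.1 (arXiv:1704.06608 p. 9) (shape)] -/
theorem openInputNotRam_bdpDatumFlat_of_hsieh2014
    (hH : hsieh2014_exists_anticyclotomicPAdicLFunction) :
    ∀ (W : WeierstrassCurve ℚ) [W.IsElliptic] [W.IsGloballyMinimal] (p : ℕ) [Fact p.Prime]
      (N : ℕ) [NeZero N] (K : Type) [Field K] [NumberField K]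
      (Dt : ModularParametrizationData W N) (H : HeegnerDatum N (NumberField.discr K)) (ι : K →+* ℂ)
      (P : (W.baseChange K).toAffine.Point),
      ¬ Literature.NumberTheory.EllipticCurves.Rank1Residual.Ram W p →
      ClassX11b W p → 5 ≤ p → Surj W p → W.conductorNorm ℤ = N → IsImaginaryQuadratic K →
      Odd (NumberField.discr K) → ¬ (p : ℤ) ∣ NumberField.discr K → ¬ p ∣ Units.torsionOrder K →
      SatisfiesHeegnerHypothesis N K →
      (W.quadraticTwist (NumberField.discr K : ℚ)).entireLFunction 1 ≠ 0 →
      WeierstrassCurve.Affine.Point.map ι.toRatAlgHom P = heegnerPointComplex Dt H →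
      ¬ (p : ℤ) ∣ Dt.c → ¬ IsOfFinAddOrder P →
      ∀ (κ : ZpExtension K p), κ.IsAnticyclotomic →
        ∀ (γ : Field.absoluteGaloisGroup K) [Fact (κ.IsTopGenerator γ)]
          (𝔭 : HeightOneSpectrum (𝓞 K)), ((p : ℕ) : 𝓞 K) ∈ 𝔭.asIdeal →
          𝔭.asIdeal.ramificationIdx (𝓞 ℚ) = 1 → 𝔭.asIdeal.inertiaDeg (𝓞 ℚ) = 1 →
          ∃ (f : CuspForm (CongruenceSubgroup.Gamma0 N) 2), IsNewformOf W f ∧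
            ∃ ι' : PadicAlgCl p ≃+* ℂ,
              (∀ (w : InfinitePlace K) (k : 𝓞 K),
                k ∈ 𝔭.asIdeal ↔ ‖ι'.symm (w.embedding (k : K))‖ < 1) ∧
              ∃ (ΩK : ℂ) (Ωp : ℂ_[p]) (Q : PowerSeries 𝓞_ℂ_[p]),
                ΩK ≠ 0 ∧ ‖Ωp‖ = 1 ∧ R1.IsBDPLFunctionInt p ι' 𝔭 κ γ f ΩK Ωp Q := by
  intro W _ _ p _ N _ K _ _ Dt H ιK P _hnr hX _h5 _hs hN hK _hodd _hpd _hμ hHN _hLt _hP _hc _hPinf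
    κ hκ γ hγ 𝔭 h𝔭 _he _hf
  -- an embedding datum inducing `𝔭` (one of `ι₀`, `ι₀ ∘ conj`)
  obtain ⟨ι₀⟩ := PadicAlgCl.nonempty_ringEquiv_complex p
  obtain ⟨ι', -, hι'⟩ := exists_datum_forall_mem_iff p ι₀ hK h𝔭
  -- `𝔭` is the prime of `ι'` at the unique infinite place
  obtain ⟨w₀⟩ := (inferInstance : Nonempty (InfinitePlace K))
  obtain rfl : 𝔭 = primeOfEmbeddingDatum p ι' w₀.embedding :=
    eq_primeOfEmbeddingDatum_of_forall_mem_iff p ι' w₀.embedding (hι' w₀)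
  -- Hsieh 2014 Thm. A, Castella-normalised, λ-supply discharged (multr1-p2)
  obtain ⟨ΩK, Ωp, Q, hΩK, hΩp, hQ⟩ :=
    P2.exists_isBDPLFunctionInt_datum_of_hsieh2014_supplied W p hH Dt hX hN hK hHN κ hκ γ ι' w₀
  exact ⟨Dt.f, Dt.isNewformOf, ι', hι', ΩK, Ωp, Q, hΩK, hΩp, hQ⟩

/-! ### §2 H2♭ at every ♭-frame on every (¬ram) pair: the value at `𝟙` from JIMJ18 Thms. 2.10–2.11 -/

/-- **H2♭ — the ♭-twin of `stub_bdpValueNotRam` at EVERY ♭-frame on EVERY (¬ram) pair, FROM PRINT.**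
At every classical X11b datum of a (¬ram) pair — the registered binders of `stub_bdpValueNotRam`
VERBATIM — and every ♭-frame `(f, ι', Ω_K ≠ 0, Ω_p ≠ 0, Q ∈ 𝓞_{ℂ_p}⟦T⟧)` with `ι'` inducing `𝔭` and
`R1.IsBDPLFunctionInt p ι' 𝔭 κ γ f Ω_K Ω_p Q`: `Q(𝟙) = u·((1 − a_p(E) p⁻¹)·log_{ω_E} P)²` for some
`u ∈ ℂ_p` with `‖u‖ = 1`, the logarithm along `embAt K p 𝔭`. Proof = p462276's without the `R₀`-unit
step: `f = f_{Dt}`; `𝔭 = 𝔭_{ι'}`; the datum's `ι` is `w₀.embedding ∘ τ`, `τ_* P` reads the Heegner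
point through `w₀`; `continuousDisplayOnTree_of_pNew` (JIMJ18 fact) gives the display's continuity at
`𝟙` with non-zero limit at virtual periods; one-sided ♭-V1RIG gives `[T⁰]Q`; rank-one symmetry moves
`τ_* P` to `P`. CONDITIONAL on the three named facts; the binder `¬ Ram W p` is idle; nothing booked.
[cite: Castella2018Exceptional, Thm. 2.10 and Thm. 2.11 with Prop. 2.7 (arXiv:1507.04260 pp. 13–14)]
[cite: BertoliniDarmonPrasanna2013, Thm. 5.13 and Prop. 5.10]
[cite: Castella2018, Thm. 3.2 with (3.2)–(3.3) (arXiv:1704.06608 p. 9) (shape)]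
[cite: GrossZagier1986, Thm. I.6.3] [cite: Kolyvagin1990, Thm. A] -/
theorem openInputNotRam_bdpValueFlat_of_pNew (hB : thm210_thm211_bdpDisplay_pNew)
    (hGZK : rank_eq_analyticRank_of_analyticRank_le_one) (hnf : exists_isNewformOf) :
    ∀ (W : WeierstrassCurve ℚ) [W.IsElliptic] [W.IsGloballyMinimal] (p : ℕ) [Fact p.Prime]
      (N : ℕ) [NeZero N] (K : Type) [Field K] [NumberField K]
      (Dt : ModularParametrizationData W N) (H : HeegnerDatum N (NumberField.discr K)) (ι : K →+* ℂ)
      (P : (W.baseChange K).toAffine.Point),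
      ¬ Literature.NumberTheory.EllipticCurves.Rank1Residual.Ram W p →
      ClassX11b W p → 5 ≤ p → Surj W p → W.conductorNorm ℤ = N → IsImaginaryQuadratic K →
      Odd (NumberField.discr K) → ¬ (p : ℤ) ∣ NumberField.discr K → ¬ p ∣ Units.torsionOrder K →
      SatisfiesHeegnerHypothesis N K →
      (W.quadraticTwist (NumberField.discr K : ℚ)).entireLFunction 1 ≠ 0 →
      WeierstrassCurve.Affine.Point.map ι.toRatAlgHom P = heegnerPointComplex Dt H →
      ¬ (p : ℤ) ∣ Dt.c → ¬ IsOfFinAddOrder P →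
      ∀ (κ : ZpExtension K p), κ.IsAnticyclotomic →
        ∀ (γ : Field.absoluteGaloisGroup K) [Fact (κ.IsTopGenerator γ)]
          (𝔭 : HeightOneSpectrum (𝓞 K)) (h𝔭 : ((p : ℕ) : 𝓞 K) ∈ 𝔭.asIdeal)
          (he : 𝔭.asIdeal.ramificationIdx (𝓞 ℚ) = 1) (hf : 𝔭.asIdeal.inertiaDeg (𝓞 ℚ) = 1),
          ∀ (f : CuspForm (CongruenceSubgroup.Gamma0 N) 2), IsNewformOf W f →
            ∀ (ι' : PadicAlgCl p ≃+* ℂ),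
              (∀ (w : InfinitePlace K) (k : 𝓞 K),
                k ∈ 𝔭.asIdeal ↔ ‖ι'.symm (w.embedding (k : K))‖ < 1) →
              ∀ (ΩK : ℂ) (Ωp : ℂ_[p]) (Q : PowerSeries 𝓞_ℂ_[p]), ΩK ≠ 0 → Ωp ≠ 0 →
                R1.IsBDPLFunctionInt p ι' 𝔭 κ γ f ΩK Ωp Q →
                  ∃ u : ℂ_[p], ‖u‖ = 1 ∧ IntSeries.HasValueAt Q 0 (u *
                    (algebraMap ℚ_[p] ℂ_[p] (((1 : ℚ_[p]) - ((W.LFunction p : ℤ) : ℚ_[p]) *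
                      (p : ℚ_[p])⁻¹) * logOmega W p (embAt K p 𝔭 h𝔭 he hf) P)) ^ 2) := by
  intro W _ _ p _ N _ K _ _ Dt H ιK P _hnr hX h5 hs hN hK hodd hpd hμ hHN hLt hP hc hPinf κ hκ γ hγ 𝔭
    h𝔭 he hf f hfW ι' hι' ΩK Ωp Q hΩK hΩp hQ
  -- multiplicity one: the frame's newform is `f_{Dt}`
  obtain rfl : f = Dt.f := hfW.unique Dt.isNewformOf
  have hr : W.analyticRank = 1 := hX.1
  have hp2 : p ≠ 2 := hX.2.1
  -- one infinite place; `𝔭` is the prime of the embedding datum `ι'` there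
  obtain ⟨w₀⟩ := (inferInstance : Nonempty (InfinitePlace K))
  obtain rfl : 𝔭 = primeOfEmbeddingDatum p ι' w₀.embedding :=
    eq_primeOfEmbeddingDatum_of_forall_mem_iff p ι' w₀.embedding (hι' w₀)
  -- `rank_ℤ E(K) = 1` (Gross–Zagier–Kolyvagin at the classical Heegner field)
  have hrk : (W.baseChange K).mordellWeilRank = 1 :=
    mordellWeilRank_baseChange_eq_one_of_twist_ne_zero W hGZK hnf hr hK.1 hLt
  -- the datum's complex embedding is `w₀.embedding ∘ τ` for an involution `τ ∈ Gal(K/ℚ)`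
  haveI : IsGalois ℚ K := by
    haveI : Algebra.IsQuadraticExtension ℚ K := ⟨hK.1⟩
    infer_instance
  obtain ⟨σ, hσ⟩ := ComplexEmbedding.exists_comp_symm_eq_of_comp_eq (k := ℚ) w₀.embedding ιK
    (by ext x; simp)
  set τ : K →+* K := ((σ.symm : K ≃ₐ[ℚ] K) : K →+* K) with hτdef
  have hτ : ∀ x, τ (τ x) = x := by
    intro x
    have hcard : Nat.card (K ≃ₐ[ℚ] K) = 2 := by rw [IsGalois.card_aut_eq_finrank, hK.1]
    have hsq : σ.symm * σ.symm = 1 := by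
      have h := pow_card_eq_one' (G := K ≃ₐ[ℚ] K) (x := σ.symm)
      rwa [hcard, pow_two] at h
    have := congrArg (fun g : K ≃ₐ[ℚ] K ↦ g x) hsq
    simpa [hτdef, AlgEquiv.mul_apply] using this
  -- the Galois conjugate `P' = τ_* P` is the Heegner point read through `w₀.embedding`
  set P' := WeierstrassCurve.Affine.Point.map τ.toRatAlgHom P with hP'def
  have hP' : WeierstrassCurve.Affine.Point.map w₀.embedding.toRatAlgHom P' =
      heegnerPointComplex Dt H := by
    rw [hP'def, WeierstrassCurve.Affine.Point.map_map]
    have hcomp : w₀.embedding.toRatAlgHom.comp τ.toRatAlgHom = ιK.toRatAlgHom := by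
      apply AlgHom.ext
      intro x
      have := RingHom.congr_fun hσ x
      simpa [hτdef] using this
    rw [hcomp]
    exact hP
  -- THE embedding at `𝔭` induces `𝔭`
  set e : K →+* ℚ_[p] := embAt K p (primeOfEmbeddingDatum p ι' w₀.embedding) h𝔭 he hf with hedef
  have hemb : ∀ k : 𝓞 K,
      k ∈ (primeOfEmbeddingDatum p ι' w₀.embedding).asIdeal ↔ ‖e (k : K)‖ < 1 :=
    mem_asIdeal_iff_norm_embAt_lt_one _ h𝔭 he hf
  -- the display's continuity at `𝟙`, with non-zero limit, from the JIMJ18 fact (bdp g12)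
  obtain ⟨ΩK₀, Ωp₀, u, hΩK₀, hΩp₀, hu, hc0, hcont⟩ := continuousDisplayOnTree_of_pNew hB N K Dt H ιK P
    hX h5 hs hN hK hodd hpd hμ hHN hLt hP hc hPinf κ hκ γ ι' w₀ P' hP' e hemb
  -- one-sided ♭-value rigidity across periods: the constant term of `Q` is the limit
  have heq := intSeries_constantCoeff_eq_of_isBDPLFunctionInt_of_continuousValues hp2 hK hκ hγ.out
    hΩK₀ hΩK hΩp₀ hΩp hcont hc0 hQ
  -- the value shape at `τ_* P`, then at `P` by rank-one symmetry `(log τ_* P)² = (log P)²`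
  set c : ℚ_[p] := (1 : ℚ_[p]) - ((W.LFunction p : ℤ) : ℚ_[p]) * (p : ℚ_[p])⁻¹ with hcdef
  have key : ∀ x : ℚ_[p],
      (algebraMap ℚ_[p] ℂ_[p] (c * x)) ^ 2 = algebraMap ℚ_[p] ℂ_[p] (c ^ 2 * x ^ 2) := by
    intro x
    rw [← map_pow, mul_pow]
  refine ⟨u, hu, ?_⟩
  rw [key, ← R1.sq_logOmega_map_eq_of_rank_one W p e τ hτ hrk hPinf, ← key]
  have h0 := R1.intSeries_hasValueAt_zero p Q
  rw [heq] at h0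
  exact h0

end Summit.BirchSwinnertonDyer.BirchSwinnertonDyer.Theorems

end
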